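import Mathlib
import HarnessLib
import Summits.HubbardSuperconductivity.HubbardSuperconductivity.Theorems.KLProgrammeKLRegimeEnginePairTransferBudgetDressing

/-!
# Route `KLProgramme` — ENGINE child gen 8 (stmt-HubbardSuperconductivity-20437 `KLRegimeEngineV17F2`), skeleton v2 class #5 rev 3, (X).3 BUDGET ARITHMETIC (block B):
# a PROFILE TERM through the three dressing sums — `klbd_profile_dressing` (generic) and the two model instances
# `klbd_minProfile_dressing_rungProfile` (direct, `|x−y|_𝕋`) / `klbd_minProfile_dressing_rungProfile_crossed` (`|x+y−Qm′|_𝕋`)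
# (cell gate-hubbard-kl, seat hubbard-kl-k3c1-p1 g15; row 78 of CLASS5-RESOLVED-STEP.md / KLTC-INDEX v12; companion of row 77 `…BudgetDressing`)

WHY.  In the budget row of candidate «76» every explicit term `X(x,y)` of `Ran` is dressed as
`X(k,k′) + Σ_c X(k,c)ρ′(c)(3m/2) + Σ_a (3m/2)ρ(a)X(a,k′) + Σ_a Σ_c (3m/2)ρ(a)X(a,c)ρ′(c)(3m/2)` (`ρ = ρ_j`, `ρ′ = ρ_{j′}` the rung profiles of the two dressings).
Row 77 did the constants and the single convolutions of the `min` profiles; this file closes the shape: for `X ≥ 0` with row bounds `Σ_c X(x,c)ρ′(c) ≤ B′` (every `x`) and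
column bounds `Σ_a ρ(a)X(a,y) ≤ B` (every `y`), `Σρ ≤ Z`, the dressed total of `c·X` is `≤ c·X(k,k′) + c(3m/2)(B′ + B) + c(3m/2)²·Z·B′` (`klbd_profile_dressing`); instantiated on
`X = min(|x−y|_𝕋/Λₙ₊₁, Λₙ₊₁/|x−y|_𝕋)` and its crossed twin with row 77's numbers `B = B′ = (n+3)·((2·369144/π)Λₙ₊₁(1+2I) + 738288/2^I)`, `Z = 738288`.  So a profile term costs
its VALUE at `(k,k′)` — the ROOM's `min` slot — plus a CONSTANT `c·(3m/2)·(2 + (3m/2)·738288)·(n+3)·(…)` in the `2⁻ⁿ`-slot currency (choose `I := n+1`).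
Pure real arithmetic; nothing about the model's sizes is asserted; nothing asserts (X).3, (c), K3 or superconductivity.  0 kit · 0 lit.
-/

noncomputable section

namespace Summit.HubbardSuperconductivity.HubbardSuperconductivity.Theorems.KLRegimeSplit

set_option linter.dupNamespace false -- summit = problem name (single-conjunct summit), D-0017

open Finset Literature.MathematicalPhysics.QuantumLattice Literature.Probability.LatticeModels
open Summit.HubbardSuperconductivity.HubbardSuperconductivity.Theorems.KLProgrammeLegKernels
open Summit.HubbardSuperconductivity.HubbardSuperconductivity.Theorems.DispersionFlow

/-! ## §1 Generic: a nonnegative kernel with row/column convolution bounds through the dressing -/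

section Generic

/-- **A profile term through the three dressing sums**: `X ≥ 0`, rows `Σ_c X(x,c)ρ′(c) ≤ B′`, columns `Σ_a ρ(a)X(a,y) ≤ B`, `ρ ≥ 0`, `Σρ ≤ Z`, `c, m ≥ 0` ⇒
`c·X(k,k′) + Σ_c c·X(k,c)ρ′(c)(3m/2) + Σ_a (3m/2)ρ(a)·c·X(a,k′) + Σ_aΣ_c (3m/2)ρ(a)·c·X(a,c)·ρ′(c)(3m/2) ≤ c·X(k,k′) + c(3m/2)(B′ + B) + c(3m/2)²·Z·B′`. -/
theorem klbd_profile_dressing {ι : Type*} [Fintype ι] (X : ι → ι → ℝ) (ρ ρ' : ι → ℝ) {c m B B' Z : ℝ} (hc : 0 ≤ c) (hm : 0 ≤ m)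
    (hX : ∀ x y, 0 ≤ X x y) (hρ : ∀ a, 0 ≤ ρ a) (hρ' : ∀ a, 0 ≤ ρ' a) (hZ : ∑ a, ρ a ≤ Z)
    (hrow : ∀ x, ∑ c', X x c' * ρ' c' ≤ B') (hcol : ∀ y, ∑ a, ρ a * X a y ≤ B) (k k' : ι) :
    c * X k k' + ∑ c', c * X k c' * ρ' c' * (3 / 2 * m) + ∑ a, 3 / 2 * m * ρ a * (c * X a k') +
        ∑ a, ∑ c', 3 / 2 * m * ρ a * (c * X a c') * ρ' c' * (3 / 2 * m) ≤
      c * X k k' + c * (3 / 2 * m) * (B' + B) + c * (3 / 2 * m) * (3 / 2 * m) * (Z * B') := by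
  have hB' : 0 ≤ B' := (Finset.sum_nonneg fun c' _ => mul_nonneg (hX k c') (hρ' c')).trans (hrow k)
  have e1 : ∑ c', c * X k c' * ρ' c' * (3 / 2 * m) = c * (3 / 2 * m) * ∑ c', X k c' * ρ' c' := by
    rw [Finset.mul_sum]; exact Finset.sum_congr rfl fun c' _ => by ring
  have e2 : ∑ a, 3 / 2 * m * ρ a * (c * X a k') = c * (3 / 2 * m) * ∑ a, ρ a * X a k' := by
    rw [Finset.mul_sum]; exact Finset.sum_congr rfl fun a _ => by ring
  have e3 : ∑ a, ∑ c', 3 / 2 * m * ρ a * (c * X a c') * ρ' c' * (3 / 2 * m) = c * (3 / 2 * m) * (3 / 2 * m) * ∑ a, ρ a * ∑ c', X a c' * ρ' c' := by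
    rw [Finset.mul_sum]
    refine Finset.sum_congr rfl fun a _ => ?_
    rw [Finset.mul_sum, Finset.mul_sum]
    exact Finset.sum_congr rfl fun c' _ => by ring
  have h3 : ∑ a, ρ a * ∑ c', X a c' * ρ' c' ≤ Z * B' :=
    (Finset.sum_le_sum fun a _ => mul_le_mul_of_nonneg_left (hrow a) (hρ a)).trans (by rw [← Finset.sum_mul]; exact mul_le_mul_of_nonneg_right hZ hB')
  rw [e1, e2, e3]
  have hcm : 0 ≤ c * (3 / 2 * m) := by positivity
  have g1 := mul_le_mul_of_nonneg_left (hrow k) hcm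
  have g2 := mul_le_mul_of_nonneg_left (hcol k') hcm
  have g3 := mul_le_mul_of_nonneg_left h3 (mul_nonneg hcm (by positivity : (0 : ℝ) ≤ 3 / 2 * m))
  nlinarith

end Generic

/-! ## §2 The two model instances (rung-profile dressings of the `min` profiles at scale `n+1`) -/

section Instances

variable {L M : ℕ} [NeZero L] (β μ : ℝ) (K : TrigPolyC4v) {R : RenConsts} {U : ℝ} {N : ℕ}

/-- **The direct `min` profile, dressed** (`X(x,y) = min(|x−y|_𝕋/Λₙ₊₁, Λₙ₊₁/|x−y|_𝕋)`, `ρ = ρ_j`, `ρ′ = ρ_{j′}`, any shell number `I`; `W := (n+3)·((2·369144/π)Λₙ₊₁(1+2I) + 738288/2^I)`):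
`≤ c·min(|k−k′|/Λₙ₊₁, Λₙ₊₁/|k−k′|) + c(3m/2)·2W + c(3m/2)²·738288·W`. -/
theorem klbd_minProfile_dressing_rungProfile (hK : FrameOK R U N μ K) (hβ : klBetaMin ≤ β) (hβL : β ≤ L) {n j j' : ℕ} (hj' : n + 1 ≤ j') (hjj : j' ≤ j)
    (hη₀ : Real.pi / (L : ℝ) ≤ klScale klE0 (n + 1)) (I : ℕ) (Qm : TorusSite 2 L) {c m : ℝ} (hc : 0 ≤ c) (hm : 0 ≤ m) (k k' : TorusSite 2 L) :
    c * min (klTorusNorm L (k - k') / klScale klE0 (n + 1)) (klScale klE0 (n + 1) / klTorusNorm L (k - k')) +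
      ∑ c', c * min (klTorusNorm L (k - c') / klScale klE0 (n + 1)) (klScale klE0 (n + 1) / klTorusNorm L (k - c')) *
          klRungProfile L M β μ K n (softSymbolCompl L M β μ K (n + 1) j') Qm c' * (3 / 2 * m) +
      ∑ a, 3 / 2 * m * klRungProfile L M β μ K n (softSymbolCompl L M β μ K (n + 1) j) Qm a *
          (c * min (klTorusNorm L (a - k') / klScale klE0 (n + 1)) (klScale klE0 (n + 1) / klTorusNorm L (a - k'))) +
      ∑ a, ∑ c', 3 / 2 * m * klRungProfile L M β μ K n (softSymbolCompl L M β μ K (n + 1) j) Qm a *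
          (c * min (klTorusNorm L (a - c') / klScale klE0 (n + 1)) (klScale klE0 (n + 1) / klTorusNorm L (a - c'))) *
          klRungProfile L M β μ K n (softSymbolCompl L M β μ K (n + 1) j') Qm c' * (3 / 2 * m) ≤
      c * min (klTorusNorm L (k - k') / klScale klE0 (n + 1)) (klScale klE0 (n + 1) / klTorusNorm L (k - k')) +
        c * (3 / 2 * m) * (((n + 1 : ℕ) + 2) * (2 * 369144 / Real.pi * klScale klE0 (n + 1) * (1 + 2 * I) + 738288 / 2 ^ I) +
          ((n + 1 : ℕ) + 2) * (2 * 369144 / Real.pi * klScale klE0 (n + 1) * (1 + 2 * I) + 738288 / 2 ^ I)) +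
        c * (3 / 2 * m) * (3 / 2 * m) * (738288 * (((n + 1 : ℕ) + 2) * (2 * 369144 / Real.pi * klScale klE0 (n + 1) * (1 + 2 * I) + 738288 / 2 ^ I))) := by
  have hβ0 : 0 < β := pos_of_klBetaMin_le hβ
  have hΛ : 0 ≤ klScale klE0 (n + 1) := by unfold klScale klE0; positivity
  exact klbd_profile_dressing (fun x y => min (klTorusNorm L (x - y) / klScale klE0 (n + 1)) (klScale klE0 (n + 1) / klTorusNorm L (x - y))) _ _ hc hm
    (fun x y => le_min (div_nonneg (torusSupNorm_nonneg _) hΛ) (div_nonneg hΛ (torusSupNorm_nonneg _)))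
    (fun a => klRungProfile_nonneg β μ K hβ0 n _ Qm a) (fun a => klRungProfile_nonneg β μ K hβ0 n _ Qm a)
    (sum_klRungProfile_compl_le β μ K hK hβ hβL (hj'.trans hjj) Qm)
    (fun x => klbd_minProfile_conv_rungProfile_le β μ K hK hβ hβL hj' hη₀ I Qm x)
    (fun y => klbd_rungProfile_conv_minProfile_le β μ K hK hβ hβL (hj'.trans hjj) hη₀ I Qm y) k k'

/-- **The crossed `min` profile, dressed** (`X(x,y) = min(|x+y−Qm′|_𝕋/Λₙ₊₁, Λₙ₊₁/|x+y−Qm′|_𝕋)`; same numbers). -/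
theorem klbd_minProfile_dressing_rungProfile_crossed (hK : FrameOK R U N μ K) (hβ : klBetaMin ≤ β) (hβL : β ≤ L) {n j j' : ℕ} (hj' : n + 1 ≤ j') (hjj : j' ≤ j)
    (hη₀ : Real.pi / (L : ℝ) ≤ klScale klE0 (n + 1)) (I : ℕ) (Qm Qm' : TorusSite 2 L) {c m : ℝ} (hc : 0 ≤ c) (hm : 0 ≤ m) (k k' : TorusSite 2 L) :
    c * min (klTorusNorm L (k + k' - Qm') / klScale klE0 (n + 1)) (klScale klE0 (n + 1) / klTorusNorm L (k + k' - Qm')) +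
      ∑ c', c * min (klTorusNorm L (k + c' - Qm') / klScale klE0 (n + 1)) (klScale klE0 (n + 1) / klTorusNorm L (k + c' - Qm')) *
          klRungProfile L M β μ K n (softSymbolCompl L M β μ K (n + 1) j') Qm c' * (3 / 2 * m) +
      ∑ a, 3 / 2 * m * klRungProfile L M β μ K n (softSymbolCompl L M β μ K (n + 1) j) Qm a *
          (c * min (klTorusNorm L (a + k' - Qm') / klScale klE0 (n + 1)) (klScale klE0 (n + 1) / klTorusNorm L (a + k' - Qm'))) +
      ∑ a, ∑ c', 3 / 2 * m * klRungProfile L M β μ K n (softSymbolCompl L M β μ K (n + 1) j) Qm a *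
          (c * min (klTorusNorm L (a + c' - Qm') / klScale klE0 (n + 1)) (klScale klE0 (n + 1) / klTorusNorm L (a + c' - Qm'))) *
          klRungProfile L M β μ K n (softSymbolCompl L M β μ K (n + 1) j') Qm c' * (3 / 2 * m) ≤
      c * min (klTorusNorm L (k + k' - Qm') / klScale klE0 (n + 1)) (klScale klE0 (n + 1) / klTorusNorm L (k + k' - Qm')) +
        c * (3 / 2 * m) * (((n + 1 : ℕ) + 2) * (2 * 369144 / Real.pi * klScale klE0 (n + 1) * (1 + 2 * I) + 738288 / 2 ^ I) +
          ((n + 1 : ℕ) + 2) * (2 * 369144 / Real.pi * klScale klE0 (n + 1) * (1 + 2 * I) + 738288 / 2 ^ I)) +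
        c * (3 / 2 * m) * (3 / 2 * m) * (738288 * (((n + 1 : ℕ) + 2) * (2 * 369144 / Real.pi * klScale klE0 (n + 1) * (1 + 2 * I) + 738288 / 2 ^ I))) := by
  have hβ0 : 0 < β := pos_of_klBetaMin_le hβ
  have hΛ : 0 ≤ klScale klE0 (n + 1) := by unfold klScale klE0; positivity
  exact klbd_profile_dressing (fun x y => min (klTorusNorm L (x + y - Qm') / klScale klE0 (n + 1)) (klScale klE0 (n + 1) / klTorusNorm L (x + y - Qm'))) _ _ hc hm
    (fun x y => le_min (div_nonneg (torusSupNorm_nonneg _) hΛ) (div_nonneg hΛ (torusSupNorm_nonneg _)))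
    (fun a => klRungProfile_nonneg β μ K hβ0 n _ Qm a) (fun a => klRungProfile_nonneg β μ K hβ0 n _ Qm a)
    (sum_klRungProfile_compl_le β μ K hK hβ hβL (hj'.trans hjj) Qm)
    (fun x => klbd_minProfile_conv_rungProfile_le_crossed β μ K hK hβ hβL hj' hη₀ I Qm Qm' x)
    (fun y => klbd_rungProfile_conv_minProfile_le_crossed β μ K hK hβ hβL (hj'.trans hjj) hη₀ I Qm Qm' y) k k'

end Instances

end Summit.HubbardSuperconductivity.HubbardSuperconductivity.Theorems.KLRegimeSplit

end
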